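/-
Copyright (c) 2026 the pub-hodgecm-mathlib formalisation cell (harness21).  Prover seat hodgecm-mathlib-K2E1-p09 (g5), Track B ∕ K2-LIT,
h413 = `stmt-HodgeConjecture-24833`, line `K2_E1_TraceFormulaBeta`, page «EIS-RANK-ONE», deal (R3u) of the dealer K2E1-plan (g4) 2026-09-04T06:39:24Z, generic half:
the finite-level letter of ★ p857884 for a FAMILY of sections — ONE level ideal `𝔫` and ONE fibrewise mass bound `N₂` for the whole family.
-/
import Summits.HodgeConjecture.HodgeConjecture.Theorems.K2E1FlatSectionLineLevelU2     -- ★ p857884 (this seat): the finite-level letter (periodicity `exists_levelIdeal_forall_line_periodic_of_level_two'`, fibrewise binder)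
import HarnessLib

/-!
# h413 ∕ Track B «K2-LIT», «EIS-RANK-ONE» (R3u), generic half — `K2E1FlatSectionLineLevelFamilyU2`:
# ONE level `𝔫` and ONE fibrewise mass bound `N₂` for a FAMILY of level-invariant sections on the big-cell line of the quasi-split `U(2)`

Cell `pub/hodgecm-mathlib`, crux H413 = `stmt-HodgeConjecture-24833`, route `HCCMUnconditional`; dealer K2E1-plan (g4), deal (R3u) 2026-09-04T06:39:24Z (the z-UNIFORM edition of
★ p857911 B′; this file is its quadratic-extension half, the CM half is ★ `K2E1EisensteinMinusConstantTermBoundedLevelCMTwoUniform`).  THEOREMS ONLY (no `def`, no `instance`, no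
`notation`, no named-fact hypothesis, no `sorry`); lane `--kind proof --supports stmt-HodgeConjecture-24833 --as helper` (count-neutral).

THE POINT.  In ★ p857884 (`exists_levelIdeal_forall_line_periodic_of_level_two'`, `exists_fibre_majorant_of_archSmooth_of_level`) the level ideal `𝔫` is produced AFTER the section `f`
is fixed, although the tube-lemma witness (★ `exists_levelIdeal_forall_conj_line_traceZeroLine_mem_two`) depends only on the compact `K` and the open finite level `U₀`.  §1
`exists_levelIdeal_forall_forall_line_periodic_of_level_two` pulls `∃ 𝔫` IN FRONT of `f`: `f(ι(w₀)·n(θ(a, b + l))·k) = f(ι(w₀)·n(θ(a, b))·k)` for EVERY `f` right-invariant under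
`{1} × U₀`, all `k ∈ K`, `l ∈ 𝔫𝒪̂_F`.  §2 `exists_fibre_majorant_of_archSmooth_of_level_family` is ★ p857884 §2 for a family `f_p`, `p ∈ Z` (any index set), whose envelopes `𝓔_p` are
level-invariant and integrable along the line with ONE bound `N`: fibrewise majorants `A p k` with ONE `N₂` and the archimedean fibre decay `‖∫ f_p ψ_y‖ ≤ A p k b · (1 + ‖y‖)^{-m}` — the
input of the z-uniform edition B′ (★ `…LevelCMTwoUniform`, same seat).

HONEST LABEL.  Count-neutral helper; proves no printed statement; HC_CM is proved only modulo the 7 printed citations (2 remaining named inputs: hLiu418 =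
`stmt-HodgeConjecture-24832`, h413 = `stmt-HodgeConjecture-24833`) until rung 0 closes.

## References
* [WeilBNT1967] A. Weil, *Basic Number Theory* (1967), Ch. IV §2, Ch. VII §2 (adelic Fubini, lattices `𝔫𝒪̂_F`).
* [BorelJacquet1979] A. Borel, H. Jacquet, *Automorphic forms and automorphic representations*, Proc. Symp. Pure Math. 33.1 (1979), §4.1.
* [MoeglinWaldspurger1995] C. Mœglin, J.-L. Waldspurger, *Spectral decomposition and Eisenstein series* (1995), I.2.10–I.2.12.
* [Garrett2018] P. Garrett, *Modern Analysis of Automorphic Forms by Example* 1 (2018), §2.9, §12.2.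
-/

set_option autoImplicit false
set_option linter.dupNamespace false  -- the mandated namespace repeats the summit's segment (`HodgeConjecture.HodgeConjecture`)

noncomputable section

open MeasureTheory Measure Filter Topology NumberField NumberField.mixedEmbedding IsDedekindDomain MulAction Module Set
open Literature.NumberTheory.Automorphic Literature.NumberTheory.Automorphic.UnitaryGroup
open Summit.HodgeConjecture.HodgeConjecture.Cruxes.H413.K2E1FlatSectionLineRestrictionU2
open Summit.HodgeConjecture.HodgeConjecture.Cruxes.H413.K2E1FlatSectionLineRestrictionArchU2
open Summit.HodgeConjecture.HodgeConjecture.Cruxes.H413.K2E1InfiniteAdeleFourierDecay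
open Summit.HodgeConjecture.HodgeConjecture.Cruxes.H413.K2E1AdelicFourierEnvelope
open Summit.HodgeConjecture.HodgeConjecture.Cruxes.H413.K2E1FlatSectionLineLevelU2

open scoped ENNReal NNReal Classical

namespace Summit.HodgeConjecture.HodgeConjecture.Cruxes.H413.K2E1FlatSectionLineLevelFamilyU2


/-! ## §1 ONE level `𝔫` for every function right-invariant under the finite level (the witness of ★ (R1) does not depend on `f`) -/

section Level

variable {F E : Type} [Field F] [NumberField F] [Field E] [NumberField E] [Algebra F E] [Algebra.IsQuadraticExtension F E] {c : E ≃ₐ[F] E}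
  (hij : (((0 : Fin 2) : ℕ)) + 1 = ((1 : Fin 2) : ℕ)) (hN : 2 = 2 * ((0 : Fin 2) : ℕ) + 2) {δ : E}

/-- **ONE `𝔫 ≠ 0` FOR ALL level-invariant `f` AT ONCE** (the `∃ 𝔫` of ★ `exists_levelIdeal_forall_line_periodic_of_level_two'` pulled in front of `f`: the tube-lemma witness
depends only on the compact `K` and the open `U₀`): `f(ι(w₀)·n(θ(a, b + l))·k) = f(ι(w₀)·n(θ(a, b))·k)` for every `ℂ`-valued `f` right-invariant under `{1} × U₀`, all `k ∈ K`, `a`, `b`,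
`l ∈ 𝔫𝒪̂_F` — what a FAMILY of sections needs. [cite: WeilBNT1967, Ch. VII §2] [cite: BorelJacquet1979, §4.1] -/
theorem exists_levelIdeal_forall_forall_line_periodic_of_level_two (hcδ : c δ = -δ) (hδ : δ ≠ 0)
    {K : Set (quasiSplit F E c 2).Adelic} (hK : IsCompact K)
    {U₀ : Subgroup (GL (Fin 2) (FiniteAdeleRing (𝓞 E) E))} (hU₀o : IsOpen (U₀ : Set (GL (Fin 2) (FiniteAdeleRing (𝓞 E) E)))) :
    ∃ 𝔫 : Ideal (𝓞 F), 𝔫 ≠ 0 ∧ ∀ f : (quasiSplit F E c 2).Adelic → ℂ,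
      (∀ u : (quasiSplit F E c 2).Adelic, adelicVal F E c 2 ((StdForm.antidiagonal 2).over E) u ∈ U₀.map (GLn.ofFinite 2 E) → ∀ y : (quasiSplit F E c 2).Adelic, f (y * u) = f y) →
      ∀ k ∈ K, ∀ (a : InfiniteAdeleRing F) (b : FiniteAdeleRing (𝓞 F) F), ∀ l ∈ levelIdeal F 𝔫,
        f (((quasiSplit F E c 2).toAdelic (weylLongU (c : E →+* E) (rfl : ((StdForm.antidiagonal 2).over E) = ((StdForm.antidiagonal 2).over E)))) *
          ((middleRootUnipotent hij hN (Multiplicative.ofAdd (traceZeroLine F E c hcδ hδ ((a, b + l) : AdeleRing (𝓞 F) F))) : ↥(adelicUnipotent F E c 2)) : (quasiSplit F E c 2).Adelic) * k) =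
          f (((quasiSplit F E c 2).toAdelic (weylLongU (c : E →+* E) (rfl : ((StdForm.antidiagonal 2).over E) = ((StdForm.antidiagonal 2).over E)))) *
          ((middleRootUnipotent hij hN (Multiplicative.ofAdd (traceZeroLine F E c hcδ hδ ((a, b) : AdeleRing (𝓞 F) F))) : ↥(adelicUnipotent F E c 2)) : (quasiSplit F E c 2).Adelic) * k) := by
  set Uo : Set (quasiSplit F E c 2).Adelic := {v | GLn.sndHom 2 E (adelicVal F E c 2 ((StdForm.antidiagonal 2).over E) v) ∈ U₀} with hUo
  have hUoo : IsOpen Uo := hU₀o.preimage (GLn.continuous_sndHom.comp continuous_subtype_val)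
  have hUo1 : (1 : (quasiSplit F E c 2).Adelic) ∈ Uo := by
    show GLn.sndHom 2 E (adelicVal F E c 2 ((StdForm.antidiagonal 2).over E) 1) ∈ U₀
    rw [map_one, map_one]
    exact U₀.one_mem
  obtain ⟨𝔫, h𝔫, hmem⟩ := exists_levelIdeal_forall_conj_line_traceZeroLine_mem_two hij hN hcδ hδ hK hUoo hUo1
  refine ⟨𝔫, h𝔫, fun f hfU k hk a b l hl => ?_⟩
  have hfin : GLn.sndHom 2 E (adelicVal F E c 2 ((StdForm.antidiagonal 2).over E) (k⁻¹ * ((middleRootUnipotent hij hN (Multiplicative.ofAdd (traceZeroLine F E c hcδ hδ (finiteAdeleInr F l))) : ↥(adelicUnipotent F E c 2)) : (quasiSplit F E c 2).Adelic) * k)) ∈ U₀ := by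
    have h := hmem l hl k hk
    rw [← finiteAdeleInr_apply] at h
    exact h
  have hx : ((a, b + l) : AdeleRing (𝓞 F) F) =
      @HAdd.hAdd (AdeleRing (𝓞 F) F) (AdeleRing (𝓞 F) F) (AdeleRing (𝓞 F) F) instHAdd ((a, b) : AdeleRing (𝓞 F) F) (finiteAdeleInr F l) := by
    refine Prod.ext ?_ ?_
    · change a = a + 0
      rw [add_zero]
    · rfl
  rw [hx, weylLong_mul_chart_add_mul hij hN hcδ hδ ((a, b) : AdeleRing (𝓞 F) F) (finiteAdeleInr F l) k]
  exact hfU _ (adelicVal_conj_line_mem_map_ofFinite hij hN hcδ hδ U₀ k l hfin) _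

/-! ## §2 The fibrewise archimedean binder for a FAMILY of sections, finite-level form, ONE `N₂` -/

variable [MeasurableSpace (AdeleRing (𝓞 F) F)] [BorelSpace (AdeleRing (𝓞 F) F)]
  [MeasurableSpace (InfiniteAdeleRing F)] [BorelSpace (InfiniteAdeleRing F)]
  [MeasurableSpace (FiniteAdeleRing (𝓞 F) F)] [BorelSpace (FiniteAdeleRing (𝓞 F) F)]

/-- **FAMILY FORM of ★ `exists_fibre_majorant_of_archSmooth_of_level`**: for a family `f_p`, `p ∈ Z`, with envelopes `𝓔_p` right-invariant under the finite level and integrable along the line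
with ONE bound `N` for all `p ∈ Z`, `k ∈ K`, and `hφarch` for every `p ∈ Z`: majorants `A p k` with ONE `N₂` for all `p ∈ Z`, `k ∈ K`, and the fibre bound — same proof as ★ p857884 §2 with
§1's `p`-independent `𝔫`. [cite: MoeglinWaldspurger1995, I.2.10–I.2.12] [cite: Garrett2018, §2.9, §12.2] -/
theorem exists_fibre_majorant_of_archSmooth_of_level_family (hcδ : c δ = -δ) (hδ : δ ≠ 0)
    (μ : Measure (AdeleRing (𝓞 F) F)) [μ.IsAddHaarMeasure]
    (μ₁ : Measure (InfiniteAdeleRing F)) [μ₁.IsAddHaarMeasure] (μ₂ : Measure (FiniteAdeleRing (𝓞 F) F)) [μ₂.IsAddHaarMeasure]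
    {K : Set (quasiSplit F E c 2).Adelic} (hK : IsCompact K)
    {U₀ : Subgroup (GL (Fin 2) (FiniteAdeleRing (𝓞 E) E))} (hU₀o : IsOpen (U₀ : Set (GL (Fin 2) (FiniteAdeleRing (𝓞 E) E))))
    {P : Type*} {Z : Set P} {f : P → (quasiSplit F E c 2).Adelic → ℂ}
    {𝓔 : P → (quasiSplit F E c 2).Adelic → ℝ} (h𝓔U : ∀ p ∈ Z, ∀ u : (quasiSplit F E c 2).Adelic, adelicVal F E c 2 ((StdForm.antidiagonal 2).over E) u ∈ U₀.map (GLn.ofFinite 2 E) → ∀ y : (quasiSplit F E c 2).Adelic, 𝓔 p (y * u) = 𝓔 p y)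
    {N : ℝ} (h𝓔i : ∀ p ∈ Z, ∀ k ∈ K, Integrable (fun t : AdeleRing (𝓞 F) F => 𝓔 p (((quasiSplit F E c 2).toAdelic (weylLongU (c : E →+* E) (rfl : ((StdForm.antidiagonal 2).over E) = ((StdForm.antidiagonal 2).over E)))) *
          ((middleRootUnipotent hij hN (Multiplicative.ofAdd (traceZeroLine F E c hcδ hδ t)) : ↥(adelicUnipotent F E c 2)) : (quasiSplit F E c 2).Adelic) * k)) μ)
    (h𝓔N : ∀ p ∈ Z, ∀ k ∈ K, ∫ t, 𝓔 p (((quasiSplit F E c 2).toAdelic (weylLongU (c : E →+* E) (rfl : ((StdForm.antidiagonal 2).over E) = ((StdForm.antidiagonal 2).over E)))) *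
          ((middleRootUnipotent hij hN (Multiplicative.ofAdd (traceZeroLine F E c hcδ hδ t)) : ↥(adelicUnipotent F E c 2)) : (quasiSplit F E c 2).Adelic) * k) ∂μ ≤ N)
    {m : ℕ}
    (hφarch : ∀ p ∈ Z, ∀ k ∈ K, ∀ b : FiniteAdeleRing (𝓞 F) F,
      ContDiff ℝ m ((fun a : InfiniteAdeleRing F => f p (((quasiSplit F E c 2).toAdelic (weylLongU (c : E →+* E) (rfl : ((StdForm.antidiagonal 2).over E) = ((StdForm.antidiagonal 2).over E)))) *
          ((middleRootUnipotent hij hN (Multiplicative.ofAdd (traceZeroLine F E c hcδ hδ ((a, b) : AdeleRing (𝓞 F) F))) : ↥(adelicUnipotent F E c 2)) : (quasiSplit F E c 2).Adelic) * k)) ∘ (InfiniteAdeleRing.ringEquiv_mixedSpace F).symm) ∧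
      ∀ j : ℕ, j ≤ m → ∀ s : mixedSpace F,
        ‖iteratedFDeriv ℝ j ((fun a : InfiniteAdeleRing F => f p (((quasiSplit F E c 2).toAdelic (weylLongU (c : E →+* E) (rfl : ((StdForm.antidiagonal 2).over E) = ((StdForm.antidiagonal 2).over E)))) *
          ((middleRootUnipotent hij hN (Multiplicative.ofAdd (traceZeroLine F E c hcδ hδ ((a, b) : AdeleRing (𝓞 F) F))) : ↥(adelicUnipotent F E c 2)) : (quasiSplit F E c 2).Adelic) * k)) ∘ (InfiniteAdeleRing.ringEquiv_mixedSpace F).symm) s‖ ≤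
          𝓔 p (((quasiSplit F E c 2).toAdelic (weylLongU (c : E →+* E) (rfl : ((StdForm.antidiagonal 2).over E) = ((StdForm.antidiagonal 2).over E)))) *
          ((middleRootUnipotent hij hN (Multiplicative.ofAdd (traceZeroLine F E c hcδ hδ ((((InfiniteAdeleRing.ringEquiv_mixedSpace F).symm s), b) : AdeleRing (𝓞 F) F))) : ↥(adelicUnipotent F E c 2)) : (quasiSplit F E c 2).Adelic) * k)) :
    ∃ (A : P → (quasiSplit F E c 2).Adelic → FiniteAdeleRing (𝓞 F) F → ℝ) (N₂ : ℝ), 0 ≤ N₂ ∧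
      (∀ p ∈ Z, ∀ k ∈ K, Integrable (A p k) μ₂ ∧ ∫ b, A p k b ∂μ₂ ≤ N₂) ∧
      ∀ p ∈ Z, ∀ k ∈ K, ∀ (b : FiniteAdeleRing (𝓞 F) F) (y : InfiniteAdeleRing F),
        ‖∫ a, f p (((quasiSplit F E c 2).toAdelic (weylLongU (c : E →+* E) (rfl : ((StdForm.antidiagonal 2).over E) = ((StdForm.antidiagonal 2).over E)))) *
          ((middleRootUnipotent hij hN (Multiplicative.ofAdd (traceZeroLine F E c hcδ hδ ((a, b) : AdeleRing (𝓞 F) F))) : ↥(adelicUnipotent F E c 2)) : (quasiSplit F E c 2).Adelic) * k) *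
          (adeleAddChar F (infiniteAdeleInl F (y * a)) : ℂ) ∂μ₁‖ ≤ A p k b * (1 + ‖InfiniteAdeleRing.ringEquiv_mixedSpace F y‖) ^ (-(m : ℝ)) := by
  haveI := secondCountableTopology_infiniteAdeleRing F
  haveI := secondCountableTopology_finiteAdeleRing F
  haveI := locallyCompactSpace_finiteAdeleRing' F
  obtain ⟨C, hC0, hC⟩ := exists_forall_norm_integral_mul_adeleAddChar_le F μ₁ m
  obtain ⟨c₀, hc₀, hc⟩ := exists_integral_adele_eq_smul_integral_prod F μ μ₁ μ₂
  -- ONE level `𝔫` for every envelope of the family (§1, applied to `(𝓔_p : ℂ)`)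
  obtain ⟨𝔫, -, hper⟩ := exists_levelIdeal_forall_forall_line_periodic_of_level_two hij hN hcδ hδ hK hU₀o
  set e : P → (quasiSplit F E c 2).Adelic → InfiniteAdeleRing F × FiniteAdeleRing (𝓞 F) F → ℝ := fun p k q =>
    𝓔 p (((quasiSplit F E c 2).toAdelic (weylLongU (c : E →+* E) (rfl : ((StdForm.antidiagonal 2).over E) = ((StdForm.antidiagonal 2).over E)))) *
          ((middleRootUnipotent hij hN (Multiplicative.ofAdd (traceZeroLine F E c hcδ hδ ((q.1, q.2) : AdeleRing (𝓞 F) F))) : ↥(adelicUnipotent F E c 2)) : (quasiSplit F E c 2).Adelic) * k) with he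
  have hei : ∀ p ∈ Z, ∀ k ∈ K, Integrable (e p k) (μ₁.prod μ₂) := fun p hp k hk => by
    have h := (integrable_iff_integrable_prod F μ μ₁ μ₂ (fun t : AdeleRing (𝓞 F) F => ((𝓔 p (((quasiSplit F E c 2).toAdelic (weylLongU (c : E →+* E) (rfl : ((StdForm.antidiagonal 2).over E) = ((StdForm.antidiagonal 2).over E)))) *
          ((middleRootUnipotent hij hN (Multiplicative.ofAdd (traceZeroLine F E c hcδ hδ t)) : ↥(adelicUnipotent F E c 2)) : (quasiSplit F E c 2).Adelic) * k) : ℝ) : ℂ))).1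
      ((h𝓔i p hp k hk).ofReal)
    exact (h.re).congr (Eventually.of_forall fun q => by simp only [he, RCLike.re_to_complex, Complex.ofReal_re])
  have hfib : ∀ p ∈ Z, ∀ k ∈ K, ∀ b : FiniteAdeleRing (𝓞 F) F, Integrable (fun a => e p k (a, b)) μ₁ := fun p hp k hk b => by
    refine integrable_fibre_of_periodic F μ₁ μ₂ (hei p hp k hk) 𝔫 (fun a b' l hl => ?_) b
    have h := hper (fun y => ((𝓔 p y : ℝ) : ℂ)) (fun u hu y => by simp only [h𝓔U p hp u hu y]) k hk a b' l hl
    simp only [he]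
    exact_mod_cast h
  refine ⟨fun p k b => C * (((m : ℝ) + 1) * ∫ a, e p k (a, b) ∂μ₁), C * (((m : ℝ) + 1) * ((c₀ : ℝ)⁻¹ * max N 0)), ?_, fun p hp k hk => ⟨?_, ?_⟩, fun p hp k hk b y => ?_⟩
  · exact mul_nonneg hC0 (mul_nonneg (by positivity) (mul_nonneg (inv_nonneg.2 (NNReal.coe_nonneg c₀)) (le_max_right _ _)))
  · exact ((hei p hp k hk).integral_prod_right.const_mul ((m : ℝ) + 1)).const_mul C
  · rw [integral_const_mul, integral_const_mul]
    refine mul_le_mul_of_nonneg_left (mul_le_mul_of_nonneg_left ?_ (by positivity)) hC0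
    rw [← integral_prod_symm (e p k) (hei p hp k hk)]
    have hreal := integral_real_adele_eq_mul_integral_prod F hc (fun t : AdeleRing (𝓞 F) F => 𝓔 p (((quasiSplit F E c 2).toAdelic (weylLongU (c : E →+* E) (rfl : ((StdForm.antidiagonal 2).over E) = ((StdForm.antidiagonal 2).over E)))) *
          ((middleRootUnipotent hij hN (Multiplicative.ofAdd (traceZeroLine F E c hcδ hδ t)) : ↥(adelicUnipotent F E c 2)) : (quasiSplit F E c 2).Adelic) * k))
    have hc₀' : (c₀ : ℝ) ≠ 0 := (NNReal.coe_pos.2 hc₀).ne'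
    have heq : ∫ q, e p k q ∂(μ₁.prod μ₂) = (c₀ : ℝ)⁻¹ * ∫ t, 𝓔 p (((quasiSplit F E c 2).toAdelic (weylLongU (c : E →+* E) (rfl : ((StdForm.antidiagonal 2).over E) = ((StdForm.antidiagonal 2).over E)))) *
          ((middleRootUnipotent hij hN (Multiplicative.ofAdd (traceZeroLine F E c hcδ hδ t)) : ↥(adelicUnipotent F E c 2)) : (quasiSplit F E c 2).Adelic) * k) ∂μ := by
      rw [hreal, ← mul_assoc, inv_mul_cancel₀ hc₀', one_mul]
    rw [heq]
    exact mul_le_mul_of_nonneg_left ((h𝓔N p hp k hk).trans (le_max_left _ _)) (inv_nonneg.2 (NNReal.coe_nonneg c₀))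
  · obtain ⟨hcd, henv⟩ := hφarch p hp k hk b
    exact norm_integral_fibre_le_of_contDiff F μ₁ hC0 hC hcd (hfib p hp k hk b) (fun j hj s => henv j hj s) y

end Level

end Summit.HodgeConjecture.HodgeConjecture.Cruxes.H413.K2E1FlatSectionLineLevelFamilyU2

end
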